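import Mathlib.NumberTheory.DirichletCharacter.Basic
import Mathlib.NumberTheory.LegendreSymbol.ZModChar
import Mathlib.RingTheory.ZMod.UnitsCyclic
import Literature.NumberTheory.EllipticCurves.PAdicLFunctionProofs
import HarnessLib

/-!
# Route `ThetaPartnerAtTwo` (TP2), crux K3 `SignedKatoDivisibilityUpToAtTwo` (item stmt-BirchSwinnertonDyer-20308) /
# K3P′ (stmt-BirchSwinnertonDyer-25631), line `colemanrat` v12 — brick MULT-AVOID, §1: the ABSTRACT AVOIDANCE LEMMA for
# Kato's four-cusp multiplier

Width seat `bsd-wall-tp2-p2x-w5` g0 (cell `bsd-wall`). HONEST FRAMING: theorems only (no definition, no named fact, no instance,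
no `sorry`); finite Fourier analysis over an arbitrary field; closes no item; K3 / K3P′ are NOT settled and BSD is NOT proved by
any of this.

## Where this sits

The published-input stub of line `colemanrat` (CORE_pair, v12; equivalently CORE_χ, `…CoreOfCharValues`) asks, for EVERY
height-one prime `𝔭 ∌ 2` of `Λ = ℤ₂⟦T⟧`, for a Kato class whose Mazur–Tate values carry a multiplier `μ ∈ Λ` with `μ ∉ 𝔭`.
For Kato's `(c, d, a(A))`-elements (the tree's `Kato2004.ZetaBody`, value law (C5), four-cusp factor
`EulerSystemValues.cuspFactor`) the `Λ`-adic multiplier is (`Kato2004.katoMultiplier`, Lemma 13.10 (1))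
`μ_a = c²d²[a/A]⁻ − cd²[ac/A]⁻·Ψ_c − c²d[ad′/A]⁻·Ψ_d + cd[acd′/A]⁻·Ψ_cΨ_d` (no tame Euler factors when `A` is a power
of `p`), `Ψ_c, Ψ_d ∈ Λˣ` the images of `σ_c, σ_d`. Kato (§13.9–13.14, Lemma 13.11, Rohrlich) chooses the auxiliary
data per `𝔭`; the lead's memo `G6-LEAD-v11.md` §ASSEMBLY records this step without proof. This file:
* §1 `sum_inv_mul_fourTerm_eq` — the `ψ̄`-weighted sum over `a` of the four-term family is
  `(Σ_a ψ̄(a)F(a)) · cd · (c − ψ(c)x)(d − ψ̄(d)y)` (Kato Lemma 13.11 (1)); `exists_fourTerm_ne_zero` — **the avoidance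
  lemma**: over ANY field `L`, if at least three characters `ψ` mod `A`, pairwise distinguished by their values at `c` and
  at `d`, have `Σ_a ψ̄(a)F(a) ≠ 0`, then for all `x, y ∈ L` some cusp `a` has
  `c²d²F(a) − cd²F(ac)x − c²dF(ad⁻¹)y + cdF(acd⁻¹)xy ≠ 0` (each good `ψ` forces `ψ(c)x = c` or `ψ(d⁻¹)y = d`, and each
  equation holds for at most one `ψ`) — no hypothesis on `x, y`, no structure theory of the prime.
* §2 `exists_three_odd_primitive` — three ODD PRIMITIVE characters mod `2^{k+3}` (`k ≥ 2`) with distinct values at `5`,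
  over any field of characteristic `≠ 2` with enough roots of unity (`ω·ψ^{2i+1}`, `ψ` the tree's primitive even character).
Sequel (`…MultiplierAvoidanceAtTwo`): with `L ⊇ Λ/𝔭`, `F(a) = [a/2^{k+3}]⁻_f` and Rohrlich at `2` + Birch (tree theorems)
this yields `μ_a ∉ 𝔭` for some `a`.

References: [Kato2004Asterisque] Thm. 6.6 (1) (p. 163), §13.9 (p. 229), Lemma 13.10 (1) (p. 230), Lemma 13.11 (pp. 230–231),
§13.13–13.14 (pp. 232–234); [RohrlichInventiones1984] Theorem (p. 409).
-/

set_option autoImplicit false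
-- the Theorems namespace of this sub repeats the summit name by design (D-0017 nested layout)
set_option linter.dupNamespace false

noncomputable section

open scoped Classical

open Finset Literature.NumberTheory.EllipticCurves

namespace Summit.BirchSwinnertonDyer.BirchSwinnertonDyer.Theorems.SignedKatoOffTwo.MultAvoid

/-! ## §1 Fourier analysis of the four-term family in the cusp variable `a` -/

section Abstract

variable {L : Type*} [Field L] {A : ℕ} [NeZero A]

omit [NeZero A] in
/-- `ψ⁻¹(u⁻¹) = ψ(u)` for a unit `u` (values of a character at units are units). [folklore] -/
theorem inv_apply_units_inv (ψ : DirichletCharacter L A) (u : (ZMod A)ˣ) :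
    ψ⁻¹ ((u⁻¹ : (ZMod A)ˣ) : ZMod A) = ψ u := by
  rw [MulChar.inv_apply, Ring.inverse_unit, inv_inv]

omit [NeZero A] in
/-- `ψ(u⁻¹) = (ψ u)⁻¹` in the field `L`, for a unit `u`. [folklore] -/
theorem apply_units_inv_eq_inv (ψ : DirichletCharacter L A) (u : (ZMod A)ˣ) :
    ψ ((u⁻¹ : (ZMod A)ˣ) : ZMod A) = (ψ u)⁻¹ := by
  have h : ψ ((u⁻¹ : (ZMod A)ˣ) : ZMod A) * ψ u = 1 := by
    rw [← map_mul, ← Units.val_mul, inv_mul_cancel, Units.val_one, map_one]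
  exact eq_inv_of_mul_eq_one_left h

/-- **Re-indexing a `ψ̄`-weighted sum by a unit** (the step «13.11 (1) follows from 13.10 (1)», Kato p. 231):
`Σ_{a mod A} ψ⁻¹(a) F(a·u) = ψ(u) · Σ_{a mod A} ψ⁻¹(a) F(a)` for a unit `u` of `ℤ/A`.
[cite: Kato2004Asterisque, Lemma 13.11 (1) (p. 231)] -/
theorem sum_inv_mul_comp_mul_unit (ψ : DirichletCharacter L A) (F : ZMod A → L) (u : (ZMod A)ˣ) :
    ∑ a : ZMod A, ψ⁻¹ a * F (a * u) = ψ u * ∑ a : ZMod A, ψ⁻¹ a * F a := by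
  have h1 : ∑ a : ZMod A, ψ⁻¹ a * F (a * u) =
      ∑ b : ZMod A, ψ⁻¹ (b * ((u⁻¹ : (ZMod A)ˣ) : ZMod A)) * F b := by
    refine Fintype.sum_equiv (Units.mulRight u) _ _ fun a ↦ ?_
    rw [Units.mulRight_apply, mul_assoc, Units.mul_inv, mul_one]
  rw [h1, Finset.mul_sum]
  refine Finset.sum_congr rfl fun b _ ↦ ?_
  rw [map_mul, inv_apply_units_inv]
  ring

/-- **The `ψ̄`-component of the four-term family factors** (Kato, Lemma 13.11 (1): `(c² − c²ν(c)⁻¹σ_c)(d² − d^kν(d)σ_d)`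
at `k = 2`): for units `c, d` of `ℤ/A`, scalars `γ_c, γ_d, x, y ∈ L` and `F : ℤ/A → L`,
`Σ_a ψ⁻¹(a)·(γ_c²γ_d² F(a) − γ_cγ_d² F(ac) x − γ_c²γ_d F(ad⁻¹) y + γ_cγ_d F(acd⁻¹) x y)
  = (Σ_a ψ⁻¹(a)F(a)) · γ_cγ_d · (γ_c − ψ(c) x)(γ_d − ψ(d⁻¹) y)`.
[cite: Kato2004Asterisque, Lemma 13.11 (1) (pp. 230–231)] -/
theorem sum_inv_mul_fourTerm_eq (ψ : DirichletCharacter L A) (F : ZMod A → L) (γc γd x y : L)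
    (c d : (ZMod A)ˣ) :
    ∑ a : ZMod A, ψ⁻¹ a *
        (γc ^ 2 * γd ^ 2 * F a - γc * γd ^ 2 * F (a * c) * x - γc ^ 2 * γd * F (a * ((d⁻¹ : (ZMod A)ˣ) : ZMod A)) * y +
          γc * γd * F (a * c * ((d⁻¹ : (ZMod A)ˣ) : ZMod A)) * x * y) =
      (∑ a : ZMod A, ψ⁻¹ a * F a) * (γc * γd) *
        ((γc - ψ c * x) * (γd - ψ ((d⁻¹ : (ZMod A)ˣ) : ZMod A) * y)) := by
  have h2 := sum_inv_mul_comp_mul_unit ψ F c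
  have h3 := sum_inv_mul_comp_mul_unit ψ F d⁻¹
  have h4 := sum_inv_mul_comp_mul_unit ψ F (c * d⁻¹)
  have h4' : ∑ a : ZMod A, ψ⁻¹ a * F (a * c * ((d⁻¹ : (ZMod A)ˣ) : ZMod A)) =
      ψ c * ψ ((d⁻¹ : (ZMod A)ˣ) : ZMod A) * ∑ a : ZMod A, ψ⁻¹ a * F a := by
    rw [← map_mul, ← Units.val_mul, ← h4]
    refine Finset.sum_congr rfl fun a _ ↦ ?_
    rw [Units.val_mul, mul_assoc]
  have hsplit : ∀ a : ZMod A, ψ⁻¹ a *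
      (γc ^ 2 * γd ^ 2 * F a - γc * γd ^ 2 * F (a * c) * x - γc ^ 2 * γd * F (a * ((d⁻¹ : (ZMod A)ˣ) : ZMod A)) * y +
        γc * γd * F (a * c * ((d⁻¹ : (ZMod A)ˣ) : ZMod A)) * x * y) =
      γc ^ 2 * γd ^ 2 * (ψ⁻¹ a * F a) - γc * γd ^ 2 * x * (ψ⁻¹ a * F (a * c)) -
        γc ^ 2 * γd * y * (ψ⁻¹ a * F (a * ((d⁻¹ : (ZMod A)ˣ) : ZMod A))) +
        γc * γd * x * y * (ψ⁻¹ a * F (a * c * ((d⁻¹ : (ZMod A)ˣ) : ZMod A))) := fun a ↦ by ring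
  simp_rw [hsplit]
  rw [Finset.sum_add_distrib, Finset.sum_sub_distrib, Finset.sum_sub_distrib, ← Finset.mul_sum, ← Finset.mul_sum,
    ← Finset.mul_sum, ← Finset.mul_sum, h2, h3, h4']
  ring

/-- **The avoidance lemma.** Let `L` be a field, `F : ℤ/A → L`, `c, d` units of `ℤ/A`, `γ_c, γ_d ∈ L` non-zero. Suppose a
finite set `S` of at least THREE Dirichlet characters mod `A` with values in `L` is given on which `ψ ↦ ψ(c)` and
`ψ ↦ ψ(d)` are injective and every `ψ ∈ S` has `Σ_a ψ⁻¹(a) F(a) ≠ 0`. Then for all `x, y ∈ L` some `a ∈ ℤ/A` has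
`γ_c²γ_d² F(a) − γ_cγ_d² F(ac)·x − γ_c²γ_d F(ad⁻¹)·y + γ_cγ_d F(acd⁻¹)·x·y ≠ 0`.
Proof: otherwise every `ψ ∈ S` has `(γ_c − ψ(c)x)(γ_d − ψ(d⁻¹)y) = 0` (`sum_inv_mul_fourTerm_eq`); but `ψ(c)x = γ_c`
holds for at most one `ψ ∈ S` and so does `ψ(d⁻¹)y = γ_d` — two characters cannot cover three. This is the kernel of
Kato's choice of `(c, d)` avoiding a given prime (§13.13–13.14), in a form that needs no structure theory of the prime.
[cite: Kato2004Asterisque, Lemma 13.11 (pp. 230–231), §13.13–13.14 (pp. 232–234)] -/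
theorem exists_fourTerm_ne_zero (F : ZMod A → L) {γc γd : L} (hγc : γc ≠ 0) (hγd : γd ≠ 0) (x y : L)
    (c d : (ZMod A)ˣ) (S : Finset (DirichletCharacter L A)) (hS : 2 < S.card)
    (hinjc : Set.InjOn (fun ψ : DirichletCharacter L A ↦ ψ c) S)
    (hinjd : Set.InjOn (fun ψ : DirichletCharacter L A ↦ ψ d) S)
    (hF : ∀ ψ ∈ S, ∑ a : ZMod A, ψ⁻¹ a * F a ≠ 0) :
    ∃ a : ZMod A,
      γc ^ 2 * γd ^ 2 * F a - γc * γd ^ 2 * F (a * c) * x - γc ^ 2 * γd * F (a * ((d⁻¹ : (ZMod A)ˣ) : ZMod A)) * y +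
          γc * γd * F (a * c * ((d⁻¹ : (ZMod A)ˣ) : ZMod A)) * x * y ≠ 0 := by
  by_contra! h
  have key : ∀ ψ ∈ S, ψ c * x = γc ∨ ψ ((d⁻¹ : (ZMod A)ˣ) : ZMod A) * y = γd := by
    intro ψ hψ
    have hsum : ∑ a : ZMod A, ψ⁻¹ a *
        (γc ^ 2 * γd ^ 2 * F a - γc * γd ^ 2 * F (a * c) * x - γc ^ 2 * γd * F (a * ((d⁻¹ : (ZMod A)ˣ) : ZMod A)) * y +
          γc * γd * F (a * c * ((d⁻¹ : (ZMod A)ˣ) : ZMod A)) * x * y) = 0 :=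
      Finset.sum_eq_zero fun a _ ↦ by rw [h a, mul_zero]
    rw [sum_inv_mul_fourTerm_eq] at hsum
    rcases mul_eq_zero.mp hsum with h1 | h2
    · rcases mul_eq_zero.mp h1 with h11 | h12
      · exact absurd h11 (hF ψ hψ)
      · exact absurd h12 (mul_ne_zero hγc hγd)
    · rcases mul_eq_zero.mp h2 with h3 | h3
      · exact Or.inl (sub_eq_zero.mp h3).symm
      · exact Or.inr (sub_eq_zero.mp h3).symm
  set Sc := S.filter (fun ψ : DirichletCharacter L A ↦ ψ c * x = γc) with hSc
  set Sd := S.filter (fun ψ : DirichletCharacter L A ↦ ψ ((d⁻¹ : (ZMod A)ˣ) : ZMod A) * y = γd) with hSd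
  have hcov : S ⊆ Sc ∪ Sd := by
    intro ψ hψ
    rcases key ψ hψ with h1 | h2
    · exact Finset.mem_union_left _ (Finset.mem_filter.mpr ⟨hψ, h1⟩)
    · exact Finset.mem_union_right _ (Finset.mem_filter.mpr ⟨hψ, h2⟩)
  have hSc1 : Sc.card ≤ 1 := by
    refine Finset.card_le_one.mpr fun ψ hψ ψ' hψ' ↦ ?_
    obtain ⟨hψS, hψe⟩ := Finset.mem_filter.mp hψ
    obtain ⟨hψ'S, hψ'e⟩ := Finset.mem_filter.mp hψ'
    have hx : x ≠ 0 := fun hx ↦ hγc (by rw [← hψe, hx, mul_zero])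
    exact hinjc hψS hψ'S (mul_right_cancel₀ hx (hψe.trans hψ'e.symm))
  have hSd1 : Sd.card ≤ 1 := by
    refine Finset.card_le_one.mpr fun ψ hψ ψ' hψ' ↦ ?_
    obtain ⟨hψS, hψe⟩ := Finset.mem_filter.mp hψ
    obtain ⟨hψ'S, hψ'e⟩ := Finset.mem_filter.mp hψ'
    have hy : y ≠ 0 := fun hy ↦ hγd (by rw [← hψe, hy, mul_zero])
    have hdd : ψ ((d⁻¹ : (ZMod A)ˣ) : ZMod A) = ψ' ((d⁻¹ : (ZMod A)ˣ) : ZMod A) :=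
      mul_right_cancel₀ hy (hψe.trans hψ'e.symm)
    rw [apply_units_inv_eq_inv, apply_units_inv_eq_inv, inv_inj] at hdd
    exact hinjd hψS hψ'S hdd
  have hle : S.card ≤ 2 :=
    (Finset.card_le_card hcov).trans ((Finset.card_union_le _ _).trans (by omega))
  omega

end Abstract

/-! ## §2 Three odd primitive characters mod `2^{k+3}` separated by their values at `5` (any field of characteristic `≠ 2`
with enough roots of unity) -/

section Characters

variable {K : Type*} [Field K]

/-- The kernel of `(ℤ/2^{k+3})ˣ → (ℤ/2^{k+2})ˣ` consists of `1` and `1 + 2^{k+2}`. [folklore] -/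
theorem coe_eq_of_unitsMap_eq_one (k : ℕ) (w : (ZMod (2 ^ (k + 3)))ˣ)
    (hw : ZMod.unitsMap (pow_dvd_pow 2 (k + 2).le_succ) w = 1) :
    (w : ZMod (2 ^ (k + 3))) = 1 ∨ (w : ZMod (2 ^ (k + 3))) = 1 + 2 ^ (k + 2) := by
  haveI : NeZero (2 ^ (k + 3)) := ⟨pow_ne_zero _ two_ne_zero⟩
  haveI : NeZero (2 ^ (k + 2)) := ⟨pow_ne_zero _ two_ne_zero⟩
  have h1 : Fact (1 < 2 ^ (k + 2)) := ⟨Nat.one_lt_two_pow (by omega)⟩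
  set n : ℕ := (w : ZMod (2 ^ (k + 3))).val with hn
  have hwn : (w : ZMod (2 ^ (k + 3))) = (n : ZMod (2 ^ (k + 3))) := (ZMod.natCast_zmod_val _).symm
  have hcast : ((n : ZMod (2 ^ (k + 3))).cast : ZMod (2 ^ (k + 2))) = 1 := by
    have h := congrArg (fun u : (ZMod (2 ^ (k + 2)))ˣ ↦ (u : ZMod (2 ^ (k + 2)))) hw
    simp only [ZMod.unitsMap_def, Units.coe_map, MonoidHom.coe_coe, Units.val_one] at h
    rw [hwn] at h
    exact h
  rw [ZMod.cast_natCast (pow_dvd_pow 2 (k + 2).le_succ)] at hcast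
  have hmod : n % 2 ^ (k + 2) = 1 := by
    have h := congrArg ZMod.val hcast
    rwa [ZMod.val_natCast, ZMod.val_one] at h
  have hlt : n < 2 ^ (k + 3) := ZMod.val_lt _
  have hdiv : n / 2 ^ (k + 2) < 2 := by
    rw [Nat.div_lt_iff_lt_mul (pow_pos two_pos _)]
    calc n < 2 ^ (k + 3) := hlt
      _ = 2 * 2 ^ (k + 2) := by rw [pow_succ]; ring
  have hdecomp : n = 2 ^ (k + 2) * (n / 2 ^ (k + 2)) + 1 := by
    have := Nat.div_add_mod n (2 ^ (k + 2)); rw [hmod] at this; exact this.symm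
  rw [hwn]
  interval_cases hq : n / 2 ^ (k + 2)
  · left
    rw [hdecomp]; simp
  · right
    rw [hdecomp]; push_cast; ring

/-- `5^{2^k} ≠ 1` in `ℤ/2^{k+3}` (the order of `5` is `2^{k+1}`, Mathlib `ZMod.orderOf_five`). [folklore] -/
theorem five_pow_two_pow_ne_one (k : ℕ) : (5 : ZMod (2 ^ (k + 3))) ^ 2 ^ k ≠ 1 := by
  intro h
  have hord : orderOf (5 : ZMod (2 ^ (k + 1 + 2))) = 2 ^ (k + 1) := ZMod.orderOf_five (k + 1)
  have h' : (5 : ZMod (2 ^ (k + 1 + 2))) ^ 2 ^ k = 1 := h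
  have hdvd := orderOf_dvd_of_pow_eq_one h'
  rw [hord] at hdvd
  have := Nat.le_of_dvd (pow_pos two_pos _) hdvd
  have hlt : 2 ^ k < 2 ^ (k + 1) := Nat.pow_lt_pow_right (by norm_num) (by omega)
  omega

/-- `(5^{2^k})² = 1` in `ℤ/2^{k+3}`. [folklore] -/
theorem five_pow_two_pow_sq (k : ℕ) : ((5 : ZMod (2 ^ (k + 3))) ^ 2 ^ k) ^ 2 = 1 := by
  have hord : orderOf (5 : ZMod (2 ^ (k + 1 + 2))) = 2 ^ (k + 1) := ZMod.orderOf_five (k + 1)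
  have h : (5 : ZMod (2 ^ (k + 1 + 2))) ^ 2 ^ (k + 1) = 1 := by rw [← hord]; exact pow_orderOf_eq_one _
  rw [← pow_mul, ← pow_succ]
  exact h

/-- `5^{2^k} ≡ 1 (mod 2^{k+2})`: the unit `5^{2^k}` of `ℤ/2^{k+3}` lies in the kernel of reduction to `ℤ/2^{k+2}`. [folklore] -/
theorem unitsMap_five_pow_two_pow (k : ℕ) :
    ZMod.unitsMap (pow_dvd_pow 2 (k + 2).le_succ)
        (ZMod.unitOfCoprime 5 (Nat.Coprime.pow_right (k + 3) (by norm_num : Nat.Coprime 5 2)) ^ 2 ^ k) = 1 := by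
  haveI : NeZero (2 ^ (k + 2)) := ⟨pow_ne_zero _ two_ne_zero⟩
  rw [map_pow, Units.ext_iff, Units.val_pow_eq_pow_val, ZMod.unitsMap_def, Units.coe_map, MonoidHom.coe_coe,
    ZMod.coe_unitOfCoprime, Units.val_one, Nat.cast_ofNat, map_ofNat]
  have hord : orderOf (5 : ZMod (2 ^ (k + 2))) = 2 ^ k := ZMod.orderOf_five k
  rw [← hord]
  exact pow_orderOf_eq_one _

/-- **A primitive character mod `2^{k+3}` takes the value `−1` at `5^{2^k}`** (over any field): it does not factor through
`2^{k+2}`, so it is non-trivial on the kernel `{1, 1 + 2^{k+2}} = {1, 5^{2^k}}` of the reduction, and `(5^{2^k})² = 1`.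
[cite: Washington1997, §7.2] -/
theorem apply_five_pow_two_pow_eq_neg_one (k : ℕ) {ψ : DirichletCharacter K (2 ^ (k + 3))} (hψ : ψ.IsPrimitive) :
    ψ ((5 : ZMod (2 ^ (k + 3))) ^ 2 ^ k) = -1 := by
  haveI : NeZero (2 ^ (k + 3)) := ⟨pow_ne_zero _ two_ne_zero⟩
  have hd : 2 ^ (k + 2) ∣ 2 ^ (k + 3) := pow_dvd_pow 2 (k + 2).le_succ
  have hlt : 2 ^ (k + 2) < 2 ^ (k + 3) := Nat.pow_lt_pow_right (by norm_num) (by omega)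
  have hnf : ¬ ψ.FactorsThrough (2 ^ (k + 2)) := by
    intro h
    have hle : ψ.conductor ≤ 2 ^ (k + 2) := Nat.sInf_le ((DirichletCharacter.mem_conductorSet_iff ψ).mpr h)
    rw [(DirichletCharacter.isPrimitive_def ψ).mp hψ] at hle
    omega
  rw [DirichletCharacter.factorsThrough_iff_ker_unitsMap hd] at hnf
  obtain ⟨w, hwker, hwne⟩ : ∃ w, w ∈ (ZMod.unitsMap hd).ker ∧ w ∉ ψ.toUnitHom.ker := by
    by_contra h
    push Not at h
    exact hnf fun w hw ↦ h w hw
  rw [MonoidHom.mem_ker] at hwker hwne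
  set v5 : (ZMod (2 ^ (k + 3)))ˣ :=
    ZMod.unitOfCoprime 5 (Nat.Coprime.pow_right (k + 3) (by norm_num : Nat.Coprime 5 2)) ^ 2 ^ k with hv5
  have hv5val : (v5 : ZMod (2 ^ (k + 3))) = (5 : ZMod (2 ^ (k + 3))) ^ 2 ^ k := by
    rw [hv5, Units.val_pow_eq_pow_val, ZMod.coe_unitOfCoprime, Nat.cast_ofNat]
  have hv : (5 : ZMod (2 ^ (k + 3))) ^ 2 ^ k = 1 + 2 ^ (k + 2) := by
    rcases coe_eq_of_unitsMap_eq_one k v5 (unitsMap_five_pow_two_pow k) with h | h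
    · exact absurd (hv5val ▸ h) (five_pow_two_pow_ne_one k)
    · rw [← hv5val, h]
  have hw1 : (w : ZMod (2 ^ (k + 3))) ≠ 1 := by
    intro h
    apply hwne
    have : w = 1 := Units.ext h
    rw [this, map_one]
  have hwv : (w : ZMod (2 ^ (k + 3))) = (5 : ZMod (2 ^ (k + 3))) ^ 2 ^ k := by
    rcases coe_eq_of_unitsMap_eq_one k w hwker with h | h
    · exact absurd h hw1
    · rw [h, hv]
  have hne : ψ ((5 : ZMod (2 ^ (k + 3))) ^ 2 ^ k) ≠ 1 := by
    intro h
    apply hwne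
    rw [Units.ext_iff, MulChar.coe_toUnitHom, hwv, h, Units.val_one]
  have hsq : ψ ((5 : ZMod (2 ^ (k + 3))) ^ 2 ^ k) * ψ ((5 : ZMod (2 ^ (k + 3))) ^ 2 ^ k) = 1 := by
    rw [← map_mul, ← sq, five_pow_two_pow_sq, map_one]
  rcases mul_self_eq_one_iff.mp hsq with h | h
  · exact absurd h hne
  · exact h

/-- **Primitivity criterion at a `2`-power level**: a character mod `2^{k+3}` that is non-trivial at `5^{2^k}` (an element of the
kernel of reduction mod `2^{k+2}`) is primitive. [cite: Washington1997, Ch. 3 (conductors)] -/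
theorem isPrimitive_of_apply_five_pow_two_pow_ne_one (k : ℕ) {ψ : DirichletCharacter K (2 ^ (k + 3))}
    (hψ : ψ ((5 : ZMod (2 ^ (k + 3))) ^ 2 ^ k) ≠ 1) : ψ.IsPrimitive := by
  haveI : NeZero (2 ^ (k + 3)) := ⟨pow_ne_zero _ two_ne_zero⟩
  by_contra hprim
  obtain ⟨j, hj, hjeq⟩ := (Nat.dvd_prime_pow Nat.prime_two).mp ψ.conductor_dvd_level
  have hjlt : j < k + 3 :=
    lt_of_le_of_ne hj fun h ↦ hprim (by rw [DirichletCharacter.isPrimitive_def, hjeq, h])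
  have hd : 2 ^ (k + 2) ∣ 2 ^ (k + 3) := pow_dvd_pow 2 (k + 2).le_succ
  have hfac : ψ.FactorsThrough (2 ^ (k + 2)) :=
    (ψ.mem_conductorSet_iff_conductor_dvd hd).mpr (hjeq ▸ pow_dvd_pow 2 (by omega))
  have hker := (DirichletCharacter.factorsThrough_iff_ker_unitsMap hd).mp hfac (unitsMap_five_pow_two_pow k)
  rw [MonoidHom.mem_ker, Units.ext_iff, MulChar.coe_toUnitHom, Units.val_pow_eq_pow_val, ZMod.coe_unitOfCoprime,
    Nat.cast_ofNat, Units.val_one] at hker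
  exact hψ hker

/-- **Three odd primitive characters mod `2^{k+3}` with distinct values at `5`** (`k ≥ 2`, any field of characteristic `≠ 2`
with enough `2^{k+2}`-th roots of unity): with `ψ` a primitive EVEN character of `2`-power order (the tree's
`exists_isPrimitive_even_orderOf_eq_prime_pow`) and `ω` the odd character mod `4` lifted to level `2^{k+3}`, take
`ψ_i = ω·ψ^{2i+1}`, `i = 0, 1, 2`: odd (`ω(−1) = −1`, `ψ(−1) = 1`), primitive (`ψ_i(5^{2^k}) = ψ(5^{2^k})^{2i+1} = −1`), and
`ψ_i(5) = ψ(5)^{2i+1}` are pairwise distinct because `ψ(5)^{2^k} = −1` forbids `ψ(5)² = 1` and `ψ(5)⁴ = 1`.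
[cite: Washington1997, §7.2] -/
theorem exists_three_odd_primitive (k : ℕ) (hk : 2 ≤ k) [HasEnoughRootsOfUnity K (Nat.totient (2 ^ (k + 3)))]
    (h2 : (2 : K) ≠ 0) :
    ∃ Ψ : Fin 3 → DirichletCharacter K (2 ^ (k + 3)),
      (∀ i, (Ψ i).Odd ∧ (Ψ i).IsPrimitive) ∧ Function.Injective fun i ↦ Ψ i (5 : ZMod (2 ^ (k + 3))) := by
  haveI : NeZero (2 ^ (k + 3)) := ⟨pow_ne_zero _ two_ne_zero⟩
  haveI : Fact (Nat.Prime 2) := ⟨Nat.prime_two⟩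
  obtain ⟨ψ, hψprim, hψeven, -⟩ := exists_isPrimitive_even_orderOf_eq_prime_pow K (p := 2) k
  have h4 : 4 ∣ 2 ^ (k + 3) := ⟨2 ^ (k + 1), by ring⟩
  set ω : DirichletCharacter K (2 ^ (k + 3)) :=
    DirichletCharacter.changeLevel h4 (ZMod.χ₄.ringHomComp (Int.castRingHom K)) with hω
  have hω5 : ω (5 : ZMod (2 ^ (k + 3))) = 1 := by
    have h5 : IsCoprime (5 : ℤ) (2 ^ (k + 3) : ℕ) := by
      rw [Int.isCoprime_iff_gcd_eq_one]
      exact_mod_cast Nat.Coprime.pow_right (k + 3) (by norm_num : Nat.Coprime 5 2)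
    have := DirichletCharacter.changeLevel_eq_cast_of_dvd' (ZMod.χ₄.ringHomComp (Int.castRingHom K)) h4 h5
    push_cast at this
    rw [hω, this, MulChar.ringHomComp_apply]
    have h51 : ZMod.χ₄ ((5 : ℤ) : ZMod 4) = 1 := ZMod.χ₄_int_one_mod_four (by norm_num)
    push_cast at h51
    rw [h51, map_one]
  have hωneg : ω (-1) = -1 := by
    have hm1 : IsCoprime (-1 : ℤ) (2 ^ (k + 3) : ℕ) := (isCoprime_one_left).neg_left
    have := DirichletCharacter.changeLevel_eq_cast_of_dvd' (ZMod.χ₄.ringHomComp (Int.castRingHom K)) h4 hm1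
    push_cast at this
    rw [hω, this, MulChar.ringHomComp_apply]
    have h31 : ZMod.χ₄ ((-1 : ℤ) : ZMod 4) = -1 := ZMod.χ₄_int_three_mod_four (by norm_num)
    push_cast at h31
    rw [h31, map_neg, map_one]
  set η : K := ψ (5 : ZMod (2 ^ (k + 3))) with hη
  have hηpow : η ^ 2 ^ k = -1 := by rw [hη, ← map_pow]; exact apply_five_pow_two_pow_eq_neg_one k hψprim
  have hneg1 : (-1 : K) ≠ 1 := fun h ↦ h2 (by linear_combination -h)
  have hη2 : η ^ 2 ≠ 1 := by
    intro h
    apply hneg1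
    rw [← hηpow, show 2 ^ k = 2 * 2 ^ (k - 1) by rw [← pow_succ']; congr 1; omega, pow_mul, h, one_pow]
  have hη4 : η ^ 4 ≠ 1 := by
    intro h
    apply hneg1
    rw [← hηpow, show 2 ^ k = 4 * 2 ^ (k - 2) by
      rw [show (4 : ℕ) = 2 ^ 2 by norm_num, ← pow_add]; congr 1; omega, pow_mul, h, one_pow]
  have hη0 : η ≠ 0 := fun h ↦ by
    rw [h, zero_pow (pow_ne_zero k two_ne_zero)] at hηpow
    exact one_ne_zero (neg_eq_zero.mp hηpow.symm)
  have h5unit : IsUnit (5 : ZMod (2 ^ (k + 3))) := by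
    have h := (ZMod.isUnit_iff_coprime 5 (2 ^ (k + 3))).mpr (Nat.Coprime.pow_right (k + 3) (by norm_num))
    exact_mod_cast h
  obtain ⟨u, hu⟩ := h5unit
  have hm1 : (((-1 : (ZMod (2 ^ (k + 3)))ˣ) : (ZMod (2 ^ (k + 3)))ˣ) : ZMod (2 ^ (k + 3))) = -1 := Units.coe_neg_one
  -- the three characters
  refine ⟨fun i ↦ ω * ψ ^ (2 * (i : ℕ) + 1), fun i ↦ ⟨?_, ?_⟩, ?_⟩
  · -- odd
    show (ω * ψ ^ (2 * (i : ℕ) + 1)) (-1) = -1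
    have hψ1 : (ψ ^ (2 * (i : ℕ) + 1)) (-1 : ZMod (2 ^ (k + 3))) = 1 := by
      rw [← hm1, MulChar.pow_apply_coe, hm1, hψeven, one_pow]
    rw [MulChar.coeToFun_mul, Pi.mul_apply, hωneg, hψ1, mul_one]
  · -- primitive
    refine isPrimitive_of_apply_five_pow_two_pow_ne_one k ?_
    rw [MulChar.coeToFun_mul, Pi.mul_apply, map_pow, hω5, one_pow, one_mul, ← hu, ← Units.val_pow_eq_pow_val,
      MulChar.pow_apply_coe, Units.val_pow_eq_pow_val, hu, apply_five_pow_two_pow_eq_neg_one k hψprim,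
      Odd.neg_one_pow ⟨i, rfl⟩]
    exact hneg1
  · -- injective at `5`
    intro i j hij
    simp only [MulChar.coeToFun_mul, Pi.mul_apply, hω5, one_mul] at hij
    rw [← hu, MulChar.pow_apply_coe, MulChar.pow_apply_coe, hu, ← hη] at hij
    have hpow : ∀ a b : ℕ, η ^ (2 * a + 1) = η ^ (2 * b + 1) → a ≤ b → b ≤ 2 → a = b := by
      intro a b h hab hb2
      obtain ⟨e, rfl⟩ := Nat.exists_eq_add_of_le hab
      have he : e ≤ 2 := by omega
      have hd : η ^ (2 * e) = 1 := by
        have h1 : η ^ (2 * a + 1) * η ^ (2 * e) = η ^ (2 * a + 1) * 1 := by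
          rw [mul_one, ← pow_add, h]; congr 1; ring
        exact mul_left_cancel₀ (pow_ne_zero _ hη0) h1
      interval_cases e
      · rfl
      · exact absurd (by simpa using hd) hη2
      · exact absurd (by norm_num at hd; exact hd) hη4
    rcases le_total (i : ℕ) j with h | h
    · exact Fin.ext (hpow i j hij h (by omega))
    · exact Fin.ext (hpow j i hij.symm h (by omega)).symm

end Characters

end Summit.BirchSwinnertonDyer.BirchSwinnertonDyer.Theorems.SignedKatoOffTwo.MultAvoid

end
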